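import Summits.Parity.GeneralizedHardyLittlewood.Theorems.BeyondDiagonalBeatsQuarter.OmegaWindowV3
import HarnessLib

/-!
# Route `PrimeLevelFamEdge`, crux K_B (stmt-Parity-20343), line `diagonal_kernel_split` rev 4, plan Ω:
# **F2 V4 — the exponent window stays NON-EMPTY for ANY bounded bulk exponent `κ₀ ≤ K`** (e.g. the sup-norm
# trivial ledger's `κ₀ = 5/4`)

`OmegaWindowV3.omegaWindowV3_nonempty` quantifies the bulk enhancement exponent adversarially over `κ₀ ∈ [½, 1]`
(GATE G2 §(b)). The trivial dual ledger typed by L3 (`OffDiagDualBoxSize`/`…BoxLedger`/`…StrataCount`, prover-3) uses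
the SUP bound `|Φ̂_i| ≤ ∫∫|Φ_i|` and therefore gives `κ₀ = 5/4` (prover-3's size note, STATUS 2026-08-28T14:26Z), outside
`[½,1]`; the stationary-phase size `|Φ̂_i| ≲ bulk/Z` would give `3/4` but is not typed. This file records that NOTHING in
the window argument needs `κ₀ ≤ 1`: for every `K ≥ 1` the same witnesses with the window shrunk to `b = 1 + m/(100K)`
satisfy all rows of `OmegaAdmissibleV3` for every `κ₀ ∈ [½, K]` — every `κ₀`-row reads `κ₀(Δ′−1) + ε < (…)` and
`κ₀(Δ′−1) ≤ K(Δ′−1) < m/100`. So `κ₀ = 5/4` narrows the window (`b − 1` by the factor `4/5`) and costs nothing else.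

* **`omegaWindowV3_nonempty_of_kappa_le`** — F2 V4, quantifier order of record, `∀ κ₀ ∈ [½, K]`.

Explicit rationals + `linarith`; standard axioms. Helper; closes nothing.
«The programme SEARCHES and TYPES; no claim about Landau–Siegel zeros, Theorems 1–2 of arXiv:2211.02515 or
a repaired Margin232 until a kernel theorem says so.»
-/

noncomputable section

namespace Summit.Parity.GeneralizedHardyLittlewood.Theorems.BeyondDiagonalBeatsQuarter

/-- **F2 V4: the plan-Ω window is NON-EMPTY for every bounded bulk exponent `κ₀ ∈ [½, K]`, `K ≥ 1`.**
Witnesses: `ηV = min (min ηA 1/16) (δFT/(2C_id))`, `a₀ = 2C_R/c_R`, `m = min (min (min δA η₀) (min ηZ 1/100)) δFT`,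
`b = 1 + m/(100K)`; on the window `U = 2η`, `ε = m/200`, `ε₁ = σ = m`, `δ = m/2`, `η′ = 3m/4`.
[cite: AssingBlomerLi2020, Proposition 4.1 p. 17 and §4 p. 23; MontgomeryVaughan2007, Cor. 11.10 (Page)] -/
theorem omegaWindowV3_nonempty_of_kappa_le {K : ℝ} (hK : 1 ≤ K) {ηA ηZ CR cR δFT Cid : ℝ} (hηA : 0 < ηA)
    (hηZ : 0 < ηZ) (hCR : 0 < CR) (hcR : 0 < cR) (hδFT : 0 < δFT) (hCid : 0 < Cid) {δABL : ℝ → ℝ}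
    (hδABL : ∀ ηV : ℝ, 0 < ηV → ηV ≤ ηA → 0 < δABL ηV) :
    ∃ ηV : ℝ, 0 < ηV ∧ ηV ≤ ηA ∧ ∃ a₀ : ℝ, 0 < a₀ ∧ ∀ η₀ : ℝ, 0 < η₀ →
      ∃ b : ℝ, 1 < b ∧ b < 2 ∧ ∀ Δ' : ℝ, 1 < Δ' → Δ' < b → ∀ κ₀ : ℝ, 1 / 2 ≤ κ₀ → κ₀ ≤ K →
        ∃ U ε ε₁ σ δ η' : ℝ,
          OmegaAdmissibleV3 ηA (δABL ηV) η₀ ηZ CR cR δFT Cid a₀ ηV Δ' κ₀ U ε ε₁ σ δ η' := by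
  have hK0 : 0 < K := lt_of_lt_of_le zero_lt_one hK
  set ηV : ℝ := min (min ηA (1 / 16)) (δFT / (2 * Cid)) with hηV_def
  have hηV_pos : 0 < ηV := lt_min (lt_min hηA (by norm_num)) (by positivity)
  have hηV_le : ηV ≤ ηA := (min_le_left _ _).trans (min_le_left _ _)
  have hηV_16 : ηV ≤ 1 / 16 := (min_le_left _ _).trans (min_le_right _ _)
  have hηV_FT : ηV ≤ δFT / (2 * Cid) := min_le_right _ _
  have hCidηV : Cid * ηV ≤ δFT / 2 := by
    have := mul_le_mul_of_nonneg_left hηV_FT hCid.le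
    rw [mul_div_assoc'] at this
    calc Cid * ηV ≤ Cid * δFT / (2 * Cid) := this
      _ = δFT / 2 := by field_simp
  have hδA : 0 < δABL ηV := hδABL ηV hηV_pos hηV_le
  set a₀ : ℝ := 2 * CR / cR with ha₀_def
  have ha₀_pos : 0 < a₀ := by positivity
  have hdamp : CR * Real.exp (-(cR * a₀)) < 1 := by
    have hca : cR * a₀ = 2 * CR := by rw [ha₀_def]; field_simp
    rw [hca]
    have h1 : 2 * CR + 1 ≤ Real.exp (2 * CR) := by
      have := Real.add_one_le_exp (2 * CR); linarith
    have hprod : Real.exp (-(2 * CR)) * (2 * CR + 1) ≤ 1 := by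
      calc Real.exp (-(2 * CR)) * (2 * CR + 1)
          ≤ Real.exp (-(2 * CR)) * Real.exp (2 * CR) :=
            mul_le_mul_of_nonneg_left h1 (Real.exp_pos _).le
        _ = 1 := by rw [← Real.exp_add]; simp
    nlinarith [Real.exp_pos (-(2 * CR)), hprod, hCR]
  refine ⟨ηV, hηV_pos, hηV_le, a₀, ha₀_pos, fun η₀ hη₀ ↦ ?_⟩
  set m : ℝ := min (min (min (δABL ηV) η₀) (min ηZ (1 / 100))) δFT with hm_def
  have hm_pos : 0 < m := lt_min (lt_min (lt_min hδA hη₀) (lt_min hηZ (by norm_num))) hδFT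
  have hm₁ : m ≤ min (min (δABL ηV) η₀) (min ηZ (1 / 100)) := min_le_left _ _
  have hm_δFT : m ≤ δFT := min_le_right _ _
  have hm_δA : m ≤ δABL ηV := hm₁.trans ((min_le_left _ _).trans (min_le_left _ _))
  have hm_η₀ : m ≤ η₀ := hm₁.trans ((min_le_left _ _).trans (min_le_right _ _))
  have hm_ηZ : m ≤ ηZ := hm₁.trans ((min_le_right _ _).trans (min_le_left _ _))
  have hm_100 : m ≤ 1 / 100 := hm₁.trans ((min_le_right _ _).trans (min_le_right _ _))
  have hbK : m / (100 * K) ≤ m / 100 := by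
    apply div_le_div_of_nonneg_left hm_pos.le (by norm_num) (by nlinarith)
  have hmK_pos : 0 < m / (100 * K) := by positivity
  have hmK_lt : m / (100 * K) < 1 := by
    rw [div_lt_one (by positivity)]; nlinarith
  refine ⟨1 + m / (100 * K), by linarith, by linarith, fun Δ' h1 h2 κ₀ hκ₁ hκ₂ ↦ ?_⟩
  have hη : 0 < Δ' - 1 := by linarith
  have hηmK : Δ' - 1 < m / (100 * K) := by linarith
  have hηm : Δ' - 1 < m / 100 := lt_of_lt_of_le hηmK hbK
  -- the only use of the upper bound on κ₀: κ₀(Δ′−1) ≤ K(Δ′−1) < m/100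
  have hκη : κ₀ * (Δ' - 1) < m / 100 := by
    have h1' : κ₀ * (Δ' - 1) ≤ K * (Δ' - 1) := mul_le_mul_of_nonneg_right hκ₂ hη.le
    have h2' : K * (Δ' - 1) < K * (m / (100 * K)) := mul_lt_mul_of_pos_left hηmK hK0
    have h3' : K * (m / (100 * K)) = m / 100 := by field_simp
    linarith
  have hκ0 : 0 ≤ κ₀ * (Δ' - 1) := by nlinarith
  have hκη' : κ₀ * (Δ' - 1) + m / 200 < 3 * m / 200 := by linarith
  refine ⟨2 * (Δ' - 1), m / 200, m, m, m / 2, 3 * m / 4, ?_, ?_⟩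
  · refine ⟨?_, ?_, ?_, ?_⟩
    · constructor
      · exact h1
      · linarith
      · rw [lt_div_iff₀ (by linarith)]; linarith
      · exact ha₀_pos
      · rw [lt_div_iff₀ (by linarith)]; nlinarith
      · have := mul_lt_mul_of_pos_left (show CR * Real.exp (-(cR * a₀)) < 2 by linarith) hη
        linarith
      · positivity
      · linarith
      · linarith
      · linarith
      · positivity
      · linarith
      · linarith
      · positivity
      · linarith
      · linarith
      · linarith
      · exact hηV_pos
      · exact hηV_le
      · linarith
      · positivity
      · linarith
      · linarith
      · linarith
    · linarith
    · linarith
    · linarith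
  · linarith

end Summit.Parity.GeneralizedHardyLittlewood.Theorems.BeyondDiagonalBeatsQuarter
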